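import Literature.NumberTheory.IwasawaTheory.ClassicalMuVanishesQuadraticAscentIntrinsic
import Literature.NumberTheory.IwasawaTheory.ClassicalMuVanishesRealQuadraticTwo
import Literature.NumberTheory.NumberFields.CMQuadraticExtension
import Literature.NumberTheory.QuadraticFields.SquareRootGenerator
import HarnessLib

/-!
# `μ₂ = 0` for every BIQUADRATIC number field `ℚ(√a, √b)` not containing `√2`, and every cyclotomic `ℤ₂`-extension of it — by genus theory alone
# (the `V₄` case of Ferrero–Washington at `p = 2`; proved, no definition, no named fact)

`Proofs`-style file (theorems only) in topic `NumberTheory/IwasawaTheory` (namespace `Literature.NumberTheory.IwasawaTheory`), written by the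
prover seat `bsd-line-att-p3` g34 (cell `bsd-f1-sign2`; `--supports` stmt-BirchSwinnertonDyer-22298; closes nothing).

A biquadratic field `K' = ℚ(x, y)` (`x² = a`, `y² = b`, `a, b, ab ∉ ℚ²`, `[K' : ℚ] = 4`) is Galois with group `V₄`, hence totally real (`a, b > 0`) or totally
complex (one of `a, b` negative, after relabelling). In both cases it is a quadratic extension `K(y)` of a quadratic field `K = ℚ(x)` in which NO real
place ramifies: `K'` totally real, or `K` imaginary. So this seat's signature-free ascents (`classicalMu_of_sq_eq_of_isTotallyReal`,
`classicalMu_of_sq_eq_of_isTotallyComplex`) carry `μ₂ = 0` from the quadratic field (`classicalMuVanishes_of_finrank_eq_two`) up to `K'`, provided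
`√2 ∉ K'` (linear disjointness from `ℚ_∞`; if `√2 ∈ K'` then `K'` is a layer of the tower of one of its quadratic subfields — not treated here).

* §1 plumbing for `K' ⊇ ℚ⟮x⟯ ∋ x` with `x² = a` (private: `x ∉ ℚ`, `[ℚ(x):ℚ] = 2`, `y ∉ ℚ(x)` from `b, ab ∉ ℚ²`, `[K' : ℚ(x)] = 2`);
  `isTotallyReal_of_sq_eq_of_sq_eq_of_pos` (`a, b > 0 ⟹ K'` totally real), `isTotallyComplex_adjoin_of_sq_eq_of_neg` (`a < 0 ⟹ ℚ(x)` totally complex).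
* §2 ★ `classicalMu_of_biquadratic_of_neg` (`a < 0`) and ★ `classicalMu_of_biquadratic_of_pos_of_pos` (`a, b > 0`) — the two shapes;
  ★★ **`classicalMuVanishes_of_biquadratic`** — `x² = a`, `y² = b`, `a, b, ab ∉ ℚ²`, `[K' : ℚ] = 4`, `√2 ∉ K'`: `μ₂ = 0` for every cyclotomic `ℤ₂`-extension of `K'`.

Examples: `ℚ(i, √d)`, `ℚ(√−3, √d)`, `ℚ(√Δ, √−Δ')`, totally real `ℚ(√p, √q)` (`2 ∉ ⟨p, q⟩ ℚ²`). Intended consumers: the `2`-adic BSD cells (carriers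
`ℚ(i, √Δ_W)`, genus/Heegner fields), as a fact-free replacement of `ferreroWashington1979_classicalMuVanishes` on `V₄`-fields.

References: [FerreroWashington1979] (the abelian theorem); [Iwasawa1973MuInvariants] Thm. 2/3 and proofs (pp. 7–8), §4; [Washington1997] §13.3 Prop. 13.23;
[Greenberg1976TotallyReal] (totally real towers); [NeukirchANT1999] Ch. I §5 (signatures).
-/

set_option autoImplicit false

noncomputable section

open scoped NumberField Classical
open NumberField Field IntermediateField IsDedekindDomain Polynomial

namespace Literature.NumberTheory.IwasawaTheory

open Literature.NumberTheory.EllipticCurves Literature.NumberTheory.EllipticCurves.ZpExtension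
  Literature.NumberTheory.GaloisRepresentations Literature.NumberTheory.NumberFields
  Literature.NumberTheory.QuadraticFields

variable {K' : Type} [Field K'] [NumberField K']

/-! ## §1 Plumbing: `ℚ(x) ⊆ K'`, degrees, signatures -/

/-- `x ∉ ℚ` when `x² = a` with `a ∉ ℚ²`. [folklore] -/
private theorem not_mem_range_of_sq_eq {x : K'} {a : ℚ} (hx : x ^ 2 = (a : K')) (ha : ¬ IsSquare a) :
    x ∉ Set.range (algebraMap ℚ K') := by
  rintro ⟨q, hq⟩
  apply ha
  refine ⟨q, ?_⟩
  have h : (algebraMap ℚ K') (q * q) = algebraMap ℚ K' a := by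
    rw [map_mul, hq, ← sq, hx, eq_ratCast]
  exact ((algebraMap ℚ K').injective h).symm

/-- `[ℚ(x) : ℚ] = 2` for `x² = a`, `a ∉ ℚ²`. [folklore] -/
private theorem finrank_adjoin_sqrt_eq_two {x : K'} {a : ℚ} (hx : x ^ 2 = (a : K')) (ha : ¬ IsSquare a) :
    Module.finrank ℚ ↥ℚ⟮x⟯ = 2 :=
  finrank_adjoin_simple_eq_two_of_sq_eq (by rw [hx, eq_ratCast]) (not_mem_range_of_sq_eq hx ha)

/-- **`y ∉ ℚ(x)`** for `x² = a`, `y² = b` with `b, ab ∉ ℚ²` (`a ∉ ℚ²`): writing `y = p + q x`, `2pq·x ∈ ℚ` forces `pq = 0`; `q = 0` makes `b = p²`,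
`p = 0` makes `ab = (qa)²`. [folklore] -/
private theorem not_mem_range_adjoin_of_sq_eq {x y : K'} {a b : ℚ} (hx : x ^ 2 = (a : K')) (hy : y ^ 2 = (b : K')) (ha : ¬ IsSquare a)
    (hb : ¬ IsSquare b) (hab : ¬ IsSquare (a * b)) : y ∉ Set.range (algebraMap ↥ℚ⟮x⟯ K') := by
  rintro ⟨z, hz⟩
  have hxQ := not_mem_range_of_sq_eq hx ha
  have h2 := finrank_adjoin_sqrt_eq_two hx ha
  -- `z = p + q·x` inside `ℚ(x)`
  set θ : ↥ℚ⟮x⟯ := ⟨x, mem_adjoin_simple_self ℚ x⟩ with hθ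
  have hθQ : θ ∉ Set.range (algebraMap ℚ ↥ℚ⟮x⟯) := by
    rintro ⟨q, hq⟩
    exact hxQ ⟨q, by
      have := congrArg (fun t : ↥ℚ⟮x⟯ ↦ (t : K')) hq
      simpa using this⟩
  obtain ⟨p, q, hpq⟩ := Quadratic.exists_eq_add_mul h2 hθQ z
  have hyK : y = (p : K') + (q : K') * x := by
    rw [← hz, hpq]
    simp [hθ]
  -- square: `b = p² + q²a + 2pq x`
  have hsq : ((b : ℚ) : K') = (p : K') ^ 2 + (q : K') ^ 2 * (a : K') + 2 * (p : K') * (q : K') * x := by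
    rw [← hy, hyK]
    linear_combination (q : K') ^ 2 * hx
  by_cases hpq0 : p * q = 0
  · rcases mul_eq_zero.mp hpq0 with hp | hq
    · -- `y = q x`, `b = q² a`
      apply hab
      refine ⟨q * a, ?_⟩
      have h1 : ((b : ℚ) : K') = ((q ^ 2 * a : ℚ) : K') := by rw [hsq, hp]; push_cast; ring
      have h2' : b = q ^ 2 * a := by exact_mod_cast h1
      rw [h2']; ring
    · -- `y = p`, `b = p²`
      apply hb
      refine ⟨p, ?_⟩
      have h1 : ((b : ℚ) : K') = ((p ^ 2 : ℚ) : K') := by rw [hsq, hq]; push_cast; ring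
      have h2' : b = p ^ 2 := by exact_mod_cast h1
      rw [h2']; ring
  · -- `pq ≠ 0`: then `x ∈ ℚ`
    apply hxQ
    have hp0 : p ≠ 0 := left_ne_zero_of_mul hpq0
    have hq0 : q ≠ 0 := right_ne_zero_of_mul hpq0
    have h2pq : (2 * (p : K') * (q : K')) ≠ 0 := by
      have : ((2 * p * q : ℚ) : K') ≠ 0 := by exact_mod_cast mul_ne_zero (mul_ne_zero two_ne_zero hp0) hq0
      push_cast at this; exact this
    refine ⟨(b - p ^ 2 - q ^ 2 * a) / (2 * p * q), ?_⟩
    rw [eq_ratCast]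
    push_cast
    rw [div_eq_iff h2pq]
    linear_combination hsq

/-- **`[K' : ℚ(x)] = 2`** when `[K' : ℚ] = 4` and `x² = a ∉ ℚ²`. [folklore] -/
private theorem finrank_over_adjoin_sqrt_eq_two {x : K'} {a : ℚ} (hx : x ^ 2 = (a : K')) (ha : ¬ IsSquare a) (h4 : Module.finrank ℚ K' = 4) :
    Module.finrank ↥ℚ⟮x⟯ K' = 2 := by
  have h2 : Module.finrank ℚ ↥ℚ⟮x⟯ = 2 := finrank_adjoin_sqrt_eq_two hx ha
  have htower : Module.finrank ℚ ↥ℚ⟮x⟯ * Module.finrank ↥ℚ⟮x⟯ K' = Module.finrank ℚ K' :=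
    Module.finrank_mul_finrank ℚ ↥ℚ⟮x⟯ K'
  rw [h2, h4] at htower
  omega

/-- A complex number whose square is a positive real is real. [folklore] -/
private theorem im_eq_zero_of_sq_eq_pos {z : ℂ} {r : ℝ} (hr : 0 < r) (hz : z ^ 2 = (r : ℂ)) : z.im = 0 := by
  have hre : z.re * z.re - z.im * z.im = r := by
    have := congrArg Complex.re hz
    simpa [sq, Complex.mul_re] using this
  have him : 2 * z.re * z.im = 0 := by
    have := congrArg Complex.im hz
    simp [sq, Complex.mul_im] at this
    linarith
  rcases mul_eq_zero.mp him with h | h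
  · rcases mul_eq_zero.mp h with h0 | h0
    · norm_num at h0
    · rw [h0] at hre
      nlinarith [mul_self_nonneg z.im]
  · exact h

/-- **`K' = ℚ(x, y)` with `x² = a > 0`, `y² = b > 0` (`a, b, ab ∉ ℚ²`, `[K' : ℚ] = 4`) is totally real**: every element is `u + v·y` with
`u, v ∈ ℚ(x) = ℚ + ℚx`, and every complex embedding sends `x, y` to real numbers. [cite: NeukirchANT1999, Ch. I §5 (signature of a number field)] -/
theorem isTotallyReal_of_sq_eq_of_sq_eq_of_pos {x y : K'} {a b : ℚ} (hx : x ^ 2 = (a : K')) (hy : y ^ 2 = (b : K'))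
    (ha : ¬ IsSquare a) (hb : ¬ IsSquare b) (hab : ¬ IsSquare (a * b)) (h4 : Module.finrank ℚ K' = 4) (ha0 : 0 < a) (hb0 : 0 < b) :
    IsTotallyReal K' := by
  refine ⟨fun w ↦ ?_⟩
  rw [InfinitePlace.isReal_iff, ComplexEmbedding.isReal_iff]
  set φ := w.embedding with hφ
  -- real values of `x` and `y`
  have hreal : ∀ z : K', (φ z).im = 0 → starRingEnd ℂ (φ z) = φ z := fun z hz ↦ Complex.conj_eq_iff_im.mpr hz
  have hxim : (φ x).im = 0 := im_eq_zero_of_sq_eq_pos (r := (a : ℝ)) (by exact_mod_cast ha0)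
    (by rw [← map_pow, hx, map_ratCast]; norm_cast)
  have hyim : (φ y).im = 0 := im_eq_zero_of_sq_eq_pos (r := (b : ℝ)) (by exact_mod_cast hb0)
    (by rw [← map_pow, hy, map_ratCast]; norm_cast)
  -- elements of `ℚ(x)` have real image
  have hxQ := not_mem_range_of_sq_eq hx ha
  have h2 := finrank_adjoin_sqrt_eq_two hx ha
  set θ : ↥ℚ⟮x⟯ := ⟨x, mem_adjoin_simple_self ℚ x⟩ with hθ
  have hθQ : θ ∉ Set.range (algebraMap ℚ ↥ℚ⟮x⟯) := by
    rintro ⟨q, hq⟩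
    exact hxQ ⟨q, by
      have := congrArg (fun t : ↥ℚ⟮x⟯ ↦ (t : K')) hq
      simpa using this⟩
  have hF : ∀ u : ↥ℚ⟮x⟯, (φ (u : K')).im = 0 := by
    intro u
    obtain ⟨p, q, hpq⟩ := Quadratic.exists_eq_add_mul h2 hθQ u
    have hu : (u : K') = (p : K') + (q : K') * x := by
      rw [hpq]; simp [hθ]
    rw [hu, map_add, map_mul, map_ratCast, map_ratCast, Complex.add_im, Complex.mul_im, hxim]
    simp
  -- every element is `u + v y` over `ℚ(x)`
  have hK'F := finrank_over_adjoin_sqrt_eq_two hx ha h4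
  have hyF := not_mem_range_adjoin_of_sq_eq hx hy ha hb hab
  refine RingHom.ext fun z ↦ ?_
  obtain ⟨u, v, huv⟩ := Quadratic.exists_eq_add_mul hK'F hyF z
  have hz : (φ z).im = 0 := by
    rw [huv, map_add, map_mul]
    change (φ (u : K') + φ (v : K') * φ y).im = 0
    rw [Complex.add_im, Complex.mul_im, hF u, hF v, hyim]
    simp
  rw [ComplexEmbedding.conjugate_coe_eq]
  exact hreal z hz

/-- A number field containing a square root of a NEGATIVE rational number is totally complex. [cite: NeukirchANT1999, Ch. I §5 (signature r₁, r₂)] -/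
private theorem isTotallyComplex_of_sq_eq_ratCast' {L : Type*} [Field L] [CharZero L] {d : L} {q : ℚ} (hd : d ^ 2 = (q : L))
    (hq : q < 0) : IsTotallyComplex L := by
  refine ⟨fun v ↦ ?_⟩
  rw [← InfinitePlace.not_isReal_iff_isComplex, InfinitePlace.isReal_iff]
  intro hφ
  have h1 : (hφ.embedding d : ℝ) ^ 2 = (q : ℝ) := by
    rw [← map_pow, hd, map_ratCast]
  have h2 : (0 : ℝ) ≤ (q : ℝ) := h1 ▸ sq_nonneg _
  have h3 : (q : ℝ) < 0 := by exact_mod_cast hq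
  exact absurd h2 (not_le.mpr h3)

/-- **`ℚ(x)` is totally complex (imaginary quadratic) for `x² = a < 0`.** [cite: NeukirchANT1999, Ch. I §5] -/
theorem isTotallyComplex_adjoin_of_sq_eq_of_neg {x : K'} {a : ℚ} (hx : x ^ 2 = (a : K')) (ha0 : a < 0) :
    IsTotallyComplex ↥ℚ⟮x⟯ :=
  isTotallyComplex_of_sq_eq_ratCast' (d := (⟨x, mem_adjoin_simple_self ℚ x⟩ : ↥ℚ⟮x⟯)) (q := a)
    (Subtype.ext (by push_cast; exact hx)) ha0

/-! ## §2 `μ₂ = 0` for biquadratic fields -/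

set_option maxHeartbeats 400000 in
/-- The common core: `K' ⊇ ℚ(x)` quadratic, generated by `y` (`y² = b`), `√2 ∉ K'`, and EITHER `ℚ(x)` totally complex OR `K'` totally real ⟹ `μ₂(K') = 0`
for every cyclotomic `ℤ₂`-extension (the quadratic subfield has `μ₂ = 0` by `classicalMuVanishes_of_finrank_eq_two`; the step `ℚ(x) → K'` is one of the two
signature-free ascents). [cite: Iwasawa1973MuInvariants, Thm. 2 and Thm. 3 (and proofs, pp. 7–8)] [cite: Washington1997, §13.3 Prop. 13.23] -/
private theorem classicalMu_of_biquadratic_core {x y : K'} {a b : ℚ} (hx : x ^ 2 = (a : K')) (hy : y ^ 2 = (b : K'))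
    (ha : ¬ IsSquare a) (hb : ¬ IsSquare b) (hab : ¬ IsSquare (a * b)) (h4 : Module.finrank ℚ K' = 4) (h2 : ∀ z : K', z ^ 2 ≠ 2)
    (hsig : IsTotallyComplex ↥ℚ⟮x⟯ ∨ IsTotallyReal K') :
    ∀ κ' : ZpExtension K' 2, κ'.IsCyclotomic → ClassicalMuVanishes κ' := by
  haveI : Fact (Nat.Prime 2) := ⟨Nat.prime_two⟩
  set F : IntermediateField ℚ K' := ℚ⟮x⟯ with hFdef
  have hxint : IsIntegral ℚ x := IsIntegral.of_finite ℚ x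
  haveI : FiniteDimensional ℚ ↥F := IntermediateField.adjoin.finiteDimensional hxint
  haveI : NumberField ↥F := NumberField.of_module_finite ℚ _
  have hF2 : Module.finrank ℚ ↥F = 2 := finrank_adjoin_sqrt_eq_two hx ha
  have hK'F : Module.finrank ↥F K' = 2 := finrank_over_adjoin_sqrt_eq_two hx ha h4
  have hyF : y ∉ Set.range (algebraMap ↥F K') := not_mem_range_adjoin_of_sq_eq hx hy ha hb hab
  -- `μ₂ = 0` for the quadratic field `F`
  have hμF : ∀ κP : ZpExtension ↥F 2, κP.IsCyclotomic → ClassicalMuVanishes κP :=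
    fun κP hκP ↦ classicalMuVanishes_of_finrank_eq_two ↥F hF2 κP hκP
  -- the integral generator `y' = den(b)·y`, `y'² = num(b)·den(b)`
  set N : ℤ := b.num * b.den with hNdef
  have hb0 : b ≠ 0 := fun h ↦ hb ⟨0, by rw [h, mul_zero]⟩
  have hN0 : N ≠ 0 := mul_ne_zero (Rat.num_ne_zero.mpr hb0) (by exact_mod_cast b.den_nz)
  have hysq : ((b.den : K') * y) ^ 2 = ((N : ℚ) : K') := by
    have h := Rat.mul_den_eq_num b
    rw [mul_pow, hy, hNdef]
    push_cast
    calc (b.den : K') ^ 2 * (b : K') = (b.den : K') * ((b : K') * (b.den : K')) := by ring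
      _ = (b.den : K') * (b.num : K') := by rw [show (b : K') * (b.den : K') = (b.num : K') by exact_mod_cast h]
      _ = (b.num : K') * (b.den : K') := by ring
  have hyint : IsIntegral ℤ ((b.den : K') * y) := by
    refine ⟨X ^ 2 - C N, monic_X_pow_sub_C N two_ne_zero, ?_⟩
    simp only [eval₂_sub, eval₂_X_pow, eval₂_C, hysq]
    simp
  set y' : 𝓞 K' := ⟨(b.den : K') * y, hyint⟩ with hy'def
  have hm : ((N : 𝓞 ↥F)) ≠ 0 := fun h0 ↦ hN0 (Int.cast_eq_zero.mp h0)
  have hx' : y' ^ 2 = algebraMap (𝓞 ↥F) (𝓞 K') (N : 𝓞 ↥F) := by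
    apply RingOfIntegers.ext
    change ((b.den : K') * y) ^ 2 = (((algebraMap (𝓞 ↥F) (𝓞 K') (N : 𝓞 ↥F) : 𝓞 K') : K'))
    rw [hysq, map_intCast]
    push_cast
    rfl
  -- `K' = F[y']`
  have hgen : Algebra.adjoin ↥F {((y' : 𝓞 K') : K')} = ⊤ := by
    have hyy : ((y' : 𝓞 K') : K') = (b.den : K') * y := rfl
    have hy'int : IsIntegral ↥F ((y' : 𝓞 K') : K') := IsIntegral.of_finite _ _
    have hy'F : ((y' : 𝓞 K') : K') ∉ Set.range (algebraMap ↥F K') := by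
      rintro ⟨t, ht⟩
      apply hyF
      refine ⟨(b.den : ↥F)⁻¹ * t, ?_⟩
      have hd0 : (b.den : K') ≠ 0 := by exact_mod_cast b.den_nz
      rw [map_mul, map_inv₀, map_natCast, ht, hyy]
      field_simp
    have hdeg2 : Module.finrank ↥F ↥(↥F)⟮((y' : 𝓞 K') : K')⟯ = 2 := by
      refine finrank_adjoin_simple_eq_two_of_sq_eq (a := (N : ↥F)) ?_ hy'F
      rw [hyy, hysq, map_intCast, Rat.cast_intCast]
    have htop : (↥F)⟮((y' : 𝓞 K') : K')⟯ = ⊤ :=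
      IntermediateField.eq_of_le_of_finrank_eq le_top (by rw [hdeg2, IntermediateField.finrank_top', hK'F])
    rw [← IntermediateField.adjoin_simple_toSubalgebra_of_isAlgebraic hy'int.isAlgebraic, htop, IntermediateField.top_toSubalgebra]
  -- the two signature-free ascents
  intro κ' hκ'
  rcases hsig with hC | hR
  · haveI := hC
    exact classicalMu_of_sq_eq_of_isTotallyComplex ↥F K' hK'F hm hx' hgen h2 hμF κ' hκ'
  · haveI := hR
    exact classicalMu_of_sq_eq_of_isTotallyReal ↥F K' hK'F hm hx' hgen h2 hμF κ' hκ'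

/-- ★ **`μ₂ = 0` for `ℚ(√a, √b)` with `a < 0`** (`a, b, ab ∉ ℚ²`, `[K' : ℚ] = 4`, `√2 ∉ K'`): quadratic over the imaginary quadratic `ℚ(√a)` — Iwasawa 1973
Thm. 3 («`k` totally imaginary»). E.g. `ℚ(i, √d)`, `ℚ(√−3, √d)`. [cite: Iwasawa1973MuInvariants, Thm. 3 and §4] [cite: FerreroWashington1979, Thm. (abelian K; here V₄, p = 2)] -/
theorem classicalMu_of_biquadratic_of_neg {x y : K'} {a b : ℚ} (hx : x ^ 2 = (a : K')) (hy : y ^ 2 = (b : K'))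
    (ha : ¬ IsSquare a) (hb : ¬ IsSquare b) (hab : ¬ IsSquare (a * b)) (h4 : Module.finrank ℚ K' = 4) (h2 : ∀ z : K', z ^ 2 ≠ 2)
    (ha0 : a < 0) : ∀ κ' : ZpExtension K' 2, κ'.IsCyclotomic → ClassicalMuVanishes κ' :=
  classicalMu_of_biquadratic_core hx hy ha hb hab h4 h2 (Or.inl (isTotallyComplex_adjoin_of_sq_eq_of_neg hx ha0))

/-- ★ **`μ₂ = 0` for totally real `ℚ(√a, √b)`, `a, b > 0`** (`a, b, ab ∉ ℚ²`, `[K' : ℚ] = 4`, `√2 ∉ K'`): quadratic over the real quadratic `ℚ(√a)` with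
totally real top — nothing ramifies at infinity (Iwasawa 1973 Thm. 2, proof pp. 7–8). E.g. `ℚ(√3, √5)`. [cite: Iwasawa1973MuInvariants, Thm. 2 and its proof]
[cite: Greenberg1976TotallyReal, §1] [cite: FerreroWashington1979, Thm. (abelian K; here V₄, p = 2)] -/
theorem classicalMu_of_biquadratic_of_pos_of_pos {x y : K'} {a b : ℚ} (hx : x ^ 2 = (a : K')) (hy : y ^ 2 = (b : K'))
    (ha : ¬ IsSquare a) (hb : ¬ IsSquare b) (hab : ¬ IsSquare (a * b)) (h4 : Module.finrank ℚ K' = 4) (h2 : ∀ z : K', z ^ 2 ≠ 2)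
    (ha0 : 0 < a) (hb0 : 0 < b) : ∀ κ' : ZpExtension K' 2, κ'.IsCyclotomic → ClassicalMuVanishes κ' :=
  classicalMu_of_biquadratic_core hx hy ha hb hab h4 h2 (Or.inr (isTotallyReal_of_sq_eq_of_sq_eq_of_pos hx hy ha hb hab h4 ha0 hb0))

/-- ★★ **`μ₂ = 0` FOR EVERY BIQUADRATIC NUMBER FIELD NOT CONTAINING `√2`** (Ferrero–Washington for `V₄`-fields at `p = 2`, by genus theory alone): `K'` a number
field with `[K' : ℚ] = 4` containing `x, y` with `x² = a`, `y² = b`, `a, b, ab ∉ ℚ²`, and `√2 ∉ K'`; then every cyclotomic `ℤ₂`-extension of `K'` has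
`μ = 0` (growth form). Case `a < 0` or `b < 0`: quadratic over an imaginary quadratic field; case `a, b > 0`: totally real top over a real quadratic field;
either way no real place ramifies, and the quadratic subfield has `μ₂ = 0` (`classicalMuVanishes_of_finrank_eq_two`). In print for EVERY Galois
`2`-power-degree `k/ℚ` (Iwasawa 1973 §4, case `l = 2`, via `k(√−1) ⊇ ℚ(√−1)`); the hypothesis «`√2 ∉ K'`» is a restriction of the kernel's currency
(`K' ∩ ℚ_∞ = ℚ`), not of the mathematics. [cite: FerreroWashington1979, Thm.]
[cite: Iwasawa1973MuInvariants, Thm. 2 and Thm. 3, and §4 (case l = 2)] [cite: Washington1997, §13.3 Prop. 13.23] -/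
theorem classicalMuVanishes_of_biquadratic {x y : K'} {a b : ℚ} (hx : x ^ 2 = (a : K')) (hy : y ^ 2 = (b : K'))
    (ha : ¬ IsSquare a) (hb : ¬ IsSquare b) (hab : ¬ IsSquare (a * b)) (h4 : Module.finrank ℚ K' = 4) (h2 : ∀ z : K', z ^ 2 ≠ 2)
    (κ' : ZpExtension K' 2) (hκ' : κ'.IsCyclotomic) : ClassicalMuVanishes κ' := by
  have ha0 : a ≠ 0 := fun h ↦ ha ⟨0, by rw [h, mul_zero]⟩
  have hb0 : b ≠ 0 := fun h ↦ hb ⟨0, by rw [h, mul_zero]⟩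
  rcases lt_or_gt_of_ne ha0 with ha' | ha'
  · exact classicalMu_of_biquadratic_of_neg hx hy ha hb hab h4 h2 ha' κ' hκ'
  rcases lt_or_gt_of_ne hb0 with hb' | hb'
  · have hba : ¬ IsSquare (b * a) := by rwa [mul_comm]
    exact classicalMu_of_biquadratic_of_neg hy hx hb ha hba h4 h2 hb' κ' hκ'
  · exact classicalMu_of_biquadratic_of_pos_of_pos hx hy ha hb hab h4 h2 ha' hb' κ' hκ'

end Literature.NumberTheory.IwasawaTheory

end
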